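import Mathlib.RingTheory.MvPolynomial.Basic
import Mathlib.LinearAlgebra.FiniteDimensional.Lemmas
import Mathlib.Algebra.MvPolynomial.Degrees
import Mathlib.Data.Fintype.BigOperators
import HarnessLib

/-!
# Perron's theorem, weak form: an explicit algebraic relation among `N + 1` polynomials in `N` variables

Topic `Literature/RingTheory/Nullstellensatz`. O. Perron (*Algebra I*, 1927) proved that `N + 1`
polynomials `Q_0, …, Q_N ∈ K[y_1, …, y_N]` of degrees `d_0, …, d_N` satisfy a nonzero algebraic
relation `P(Q_0, …, Q_N) = 0` of weighted degree `≤ d_0 ⋯ d_N` (weights `d_i`); A. Płoski,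
*Algebraic dependence of polynomials after O. Perron and some applications* (2005) gives a modern
proof, and Z. Jelonek, *On the effective Nullstellensatz*, Invent. Math. 162 (2005), uses it
("generalized Perron theorem") as the engine of an elementary proof of the effective
Nullstellensatz. This file proves the WEAK form that suffices for single-exponential bounds: if
every `deg Q_i ≤ δ` (`δ ≥ 1`) then there is a nonzero `P` with `P(Q) = 0` and
`deg P ≤ (N + 1) · (2 δ (N + 1))^N` (`exists_algRelation_of_totalDegree_le`). The proof is the
dimension count behind Perron's theorem with all constants wasted: the box of monomials of
`K[T_0, …, T_N]` with exponents `≤ c`, `c = (2δ(N+1))^N`, has `(c + 1)^{N+1}` elements and is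
mapped by `P ↦ P(Q)` into the polynomials of degree `≤ δ (N+1) c` in `N` variables, a space of
dimension `≤ (δ(N+1)c + 1)^N < (c+1)^{N+1}`; so the map has a kernel.

## Contents (namespace `Literature.RingTheory.Nullstellensatz`, everything proved)

* `totalDegree_aeval_le` — `deg P(Q_1, …) ≤ deg P · max deg Q_i`;
* `finrank_restrictDegree` — the box `{P : deg_{T_i} P ≤ m ∀ i}` has dimension `(m+1)^{#vars}`;
* `totalDegree_le_of_mem_restrictDegree` — its elements have total degree `≤ #vars · m`;
* `perronBound`, `perron_count` — the numerical inequality;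
* `exists_algRelation_of_totalDegree_le` — **weak Perron theorem**.

## References

* O. Perron, *Algebra I (Die Grundlagen)*, de Gruyter (1927). [Perron1927]
* A. Płoski, *Algebraic dependence of polynomials after O. Perron and some applications*, in:
  Computational Commutative and Non-Commutative Algebraic Geometry, IOS Press (2005), 167–173.
  [Ploski2005]
* Z. Jelonek, *On the effective Nullstellensatz*, Invent. Math. 162 (2005), 1–17. [Jelonek2005]
-/

noncomputable section

open MvPolynomial Module

namespace Literature.RingTheory.Nullstellensatz

/-! ### Degrees of substitutions -/

section Degrees

variable {R : Type*} [CommSemiring R] {σ τ : Type*}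

/-- `deg P(Q_1, …, Q_k) ≤ deg P · δ` when every `deg Q_i ≤ δ`. [folklore] -/
theorem totalDegree_aeval_le (Q : σ → MvPolynomial τ R) {δ : ℕ} (hQ : ∀ i, (Q i).totalDegree ≤ δ)
    (P : MvPolynomial σ R) : (aeval Q P).totalDegree ≤ P.totalDegree * δ := by
  classical
  conv_lhs => rw [P.as_sum, map_sum]
  refine totalDegree_finsetSum_le fun m hm => ?_
  rw [aeval_monomial, Finsupp.prod]
  refine (totalDegree_mul _ _).trans ?_
  have hC : (algebraMap R (MvPolynomial τ R) (coeff m P)).totalDegree = 0 := totalDegree_C _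
  rw [hC, zero_add]
  refine (totalDegree_finsetProd _ _).trans ?_
  calc ∑ i ∈ m.support, ((Q i) ^ (m i)).totalDegree
      ≤ ∑ i ∈ m.support, m i * δ := Finset.sum_le_sum fun i _ =>
          (totalDegree_pow _ _).trans (Nat.mul_le_mul_left _ (hQ i))
    _ = (m.sum fun _ e => e) * δ := by rw [Finsupp.sum, Finset.sum_mul]
    _ ≤ P.totalDegree * δ := Nat.mul_le_mul_right _ (le_totalDegree hm)

/-- Elements of the box `restrictDegree σ R m` (every exponent `≤ m`) have total degree
`≤ #σ · m`. [folklore] -/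
theorem totalDegree_le_of_mem_restrictDegree [Fintype σ] {m : ℕ} {P : MvPolynomial σ R}
    (hP : P ∈ restrictDegree σ R m) : P.totalDegree ≤ Fintype.card σ * m := by
  rw [mem_restrictDegree] at hP
  rw [totalDegree]
  refine Finset.sup_le fun s hs => ?_
  calc (s.sum fun _ e => e) = ∑ i, s i := Finsupp.sum_fintype _ _ (fun _ => rfl)
    _ ≤ ∑ _i : σ, m := Finset.sum_le_sum fun i _ => hP s hs i
    _ = Fintype.card σ * m := by rw [Finset.sum_const, Finset.card_univ, smul_eq_mul]

end Degrees

/-! ### The dimension of a box of monomials -/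

section Box

variable (σ : Type*) [Fintype σ] [DecidableEq σ] (K : Type*) [Field K]

/-- The exponents of the box `{s : σ →₀ ℕ | s i ≤ m ∀ i}` are in bijection with the functions
`σ → Fin (m + 1)`. [folklore] -/
def boxEquiv (m : ℕ) : {s : σ →₀ ℕ // ∀ i, s i ≤ m} ≃ (σ → Fin (m + 1)) where
  toFun s i := ⟨s.1 i, Nat.lt_succ_of_le (s.2 i)⟩
  invFun f := ⟨Finsupp.equivFunOnFinite.symm fun i => (f i : ℕ), fun i => by
    rw [Finsupp.coe_equivFunOnFinite_symm]
    exact Nat.le_of_lt_succ (f i).2⟩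
  left_inv s := by
    ext i
    simp
  right_inv f := by
    funext i
    ext
    simp

/-- The box of exponents is finite. [folklore] -/
instance fintypeBox (m : ℕ) : Fintype {s : σ →₀ ℕ // ∀ i, s i ≤ m} :=
  Fintype.ofEquiv _ (boxEquiv σ m).symm

/-- **`dim {P : deg_{T_i} P ≤ m ∀ i} = (m + 1)^{#σ}`** (the monomials of the box form a basis,
Mathlib's `basisRestrictSupport`). [folklore] -/
theorem finrank_restrictDegree (m : ℕ) :
    finrank K (restrictDegree σ K m) = (m + 1) ^ Fintype.card σ := by
  classical
  have h := finrank_eq_nat_card_basis (basisRestrictSupport K {s : σ →₀ ℕ | ∀ i, s i ≤ m})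
  change finrank K (restrictDegree σ K m) = Nat.card {s : σ →₀ ℕ // ∀ i, s i ≤ m} at h
  rw [h, Nat.card_congr (boxEquiv σ m), Nat.card_eq_fintype_card, Fintype.card_fun,
    Fintype.card_fin]

end Box

/-! ### The count -/

/-- The degree bound of the weak Perron theorem: `(N + 1) · (2 δ (N + 1))^N`. [folklore] -/
def perronBound (N δ : ℕ) : ℕ := (N + 1) * (2 * δ * (N + 1)) ^ N

/-- The numerical heart: with `c = (2δ(N+1))^N`, `(δ (N+1) c + 1)^N < (c + 1)^{N+1}`. [folklore] -/
theorem perron_count (N δ : ℕ) (hδ : 1 ≤ δ) :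
    (δ * ((N + 1) * (2 * δ * (N + 1)) ^ N) + 1) ^ N < ((2 * δ * (N + 1)) ^ N + 1) ^ (N + 1) := by
  set c := (2 * δ * (N + 1)) ^ N with hc
  have hc1 : 1 ≤ c := Nat.one_le_pow _ _ (by positivity)
  have h1 : 1 ≤ δ * ((N + 1) * c) := Nat.one_le_iff_ne_zero.2 (by positivity)
  have h2 : δ * ((N + 1) * c) + 1 ≤ 2 * δ * (N + 1) * c := by nlinarith
  calc (δ * ((N + 1) * c) + 1) ^ N ≤ (2 * δ * (N + 1) * c) ^ N := Nat.pow_le_pow_left h2 N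
    _ = c * c ^ N := by rw [mul_pow, ← hc]
    _ = c ^ (N + 1) := by ring
    _ < (c + 1) ^ (N + 1) := Nat.pow_lt_pow_left (Nat.lt_succ_self c) (Nat.succ_ne_zero N)

/-! ### The weak Perron theorem -/

variable {K : Type*} [Field K]

/-- **Perron's theorem, weak form.** Any `N + 1` polynomials `Q_0, …, Q_N ∈ K[y_1, …, y_N]` of
total degree `≤ δ` (`δ ≥ 1`) over a field satisfy a nonzero algebraic relation `P(Q_0, …, Q_N) = 0`
with `deg P ≤ (N + 1)(2δ(N + 1))^N`; moreover every exponent of `P` is `≤ (2δ(N+1))^N`. (Perron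
1927 and Płoski 2005 have the sharp weighted bound `∏ deg Q_i`; the present bound is what the
bare dimension count gives.) Proof: `P ↦ P(Q)` maps the `(c+1)^{N+1}`-dimensional box
`deg_{T_i} ≤ c` into polynomials of degree `≤ δ(N+1)c`, of dimension `≤ (δ(N+1)c+1)^N`, which is
smaller (`perron_count`), so the kernel is nonzero. [cite: Ploski2005, Thm. 1.1 (weak form)] -/
theorem exists_algRelation_of_totalDegree_le {N : ℕ} (Q : Fin (N + 1) → MvPolynomial (Fin N) K)
    {δ : ℕ} (hδ : 1 ≤ δ) (hQ : ∀ i, (Q i).totalDegree ≤ δ) :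
    ∃ P : MvPolynomial (Fin (N + 1)) K, P ≠ 0 ∧ aeval Q P = 0 ∧
      P ∈ restrictDegree (Fin (N + 1)) K ((2 * δ * (N + 1)) ^ N) ∧
      P.totalDegree ≤ perronBound N δ := by
  classical
  set c := (2 * δ * (N + 1)) ^ N with hc
  set V := restrictDegree (Fin (N + 1)) K c with hV
  set W := restrictDegree (Fin N) K (δ * ((N + 1) * c)) with hW
  -- `P ↦ P(Q)` maps the box `V` into `W`
  have hmap : ∀ P : MvPolynomial (Fin (N + 1)) K, P ∈ V → aeval Q P ∈ W := by
    intro P hP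
    refine restrictTotalDegree_le_restrictDegree (Fin N) K _ ((mem_restrictTotalDegree _ _ _).2 ?_)
    calc (aeval Q P).totalDegree ≤ P.totalDegree * δ := totalDegree_aeval_le Q hQ P
      _ ≤ (Fintype.card (Fin (N + 1)) * c) * δ :=
          Nat.mul_le_mul_right _ (totalDegree_le_of_mem_restrictDegree hP)
      _ = δ * ((N + 1) * c) := by rw [Fintype.card_fin]; ring
  let f : V →ₗ[K] W :=
    LinearMap.codRestrict W ((aeval Q).toLinearMap.comp V.subtype) fun P => hmap P.1 P.2
  have hlt : finrank K W < finrank K V := by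
    rw [hW, hV, finrank_restrictDegree, finrank_restrictDegree, Fintype.card_fin, Fintype.card_fin]
    exact perron_count N δ hδ
  have hker : LinearMap.ker f ≠ ⊥ := LinearMap.ker_ne_bot_of_finrank_lt hlt
  obtain ⟨P, hPker, hP0⟩ := (Submodule.ne_bot_iff _).1 hker
  refine ⟨P.1, fun h => hP0 (Subtype.ext h), ?_, P.2, ?_⟩
  · have := congrArg Subtype.val (LinearMap.mem_ker.1 hPker)
    simpa [f] using this
  · calc P.1.totalDegree ≤ Fintype.card (Fin (N + 1)) * c := totalDegree_le_of_mem_restrictDegree P.2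
      _ = perronBound N δ := by rw [Fintype.card_fin, perronBound]

end Literature.RingTheory.Nullstellensatz

end
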